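import Mathlib.Topology.Algebra.ProperAction.Basic
import Mathlib.GroupTheory.GroupAction.Quotient
import Mathlib.Topology.Algebra.IsUniformGroup.Basic
import HarnessLib

/-!
# Quotients `G ⧸ C` by a compact subgroup: proper projection, proper action, Hausdorff orbit spaces

Topic `Topology/Algebra`; namespace `Literature.Topology.Algebra` (sub-namespace `Subgroup` after the object:
the statements are about a subgroup `C` of a topological group `G`).

General topological-group facts (N. Bourbaki, *General Topology*, Chap. III §4 no. 1–2: groups operating
properly, homogeneous spaces `G/K` with `K` compact [folklore]), kernel-proved from Mathlib's `ProperSMul` API.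
For a topological group `G`, a subgroup `C ≤ G` with `C` COMPACT and a subgroup `Γ ≤ G` that is CLOSED
(e.g. discrete, `G` Hausdorff):
* `Subgroup.preimage_mk_singleton` — the fibre of `G → G ⧸ C` over `gC` is `(g * ·) '' C`;
* `Subgroup.isProperMap_mk`        — the projection `G → G ⧸ C` is a proper map;
* `Subgroup.properSMul_quotient`   — the left action of `G` on `G ⧸ C` is proper;
* `Subgroup.properSMul_subgroup_quotient` — hence so is the action of `Γ`;
* `Subgroup.t2Space_orbitQuotient`, `Subgroup.t2Space_orbitQuotient_of_discrete` — the orbit space `Γ \ (G ⧸ C)`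
  (quotient topology on `Quotient (MulAction.orbitRel Γ (G ⧸ C))`) is Hausdorff.
Typical use: `G` a real reductive group, `C = K` a maximal compact subgroup, `Γ` a discrete subgroup — the
locally symmetric space `Γ \ G / K` is Hausdorff; or `G = U(2,1)`, `C` the stabiliser of a point of the ball.

## Provenance

Reproduced for the tree under the LEAN-IN-TREE rule (2026-08-18) from the pub-hodgecm cell's package file
`HodgeCM/PerL34/ProperQuotient.lean` (DAG-node prover #06 lineage, seat pv06 generation 5, gate run 29; 92 lines,
namespace `HodgeCM.PerL34.ArchCompactK`), verbatim up to the namespace and the docstrings; Mathlib only,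
nothing cited as a hypothesis, nothing posited.
-/

set_option autoImplicit false

noncomputable section

namespace Literature.Topology.Algebra

namespace Subgroup

/-! ## Proper actions on `G ⧸ C`, `C` compact -/
section General

variable {G : Type*} [Group G] (C : Subgroup G)

/-- The fibre of `G → G ⧸ C` over `gC` is the left coset `gC = (g * ·) '' C`. [folklore] -/
theorem preimage_mk_singleton (g : G) :
    (QuotientGroup.mk : G → G ⧸ C) ⁻¹' {QuotientGroup.mk g} = (fun c : G => g * c) '' (C : Set G) := by
  ext x
  rw [Set.mem_preimage, Set.mem_singleton_iff, QuotientGroup.eq, Set.mem_image]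
  constructor
  · intro h
    exact ⟨g⁻¹ * x, by simpa [mul_inv_rev] using inv_mem h, by rw [mul_inv_cancel_left]⟩
  · rintro ⟨c, hc, rfl⟩
    simpa [mul_inv_rev] using inv_mem hc

variable [TopologicalSpace G] [IsTopologicalGroup G]

/-- For `C` compact, the projection `G → G ⧸ C` is a proper map (closed with compact fibres)
(Bourbaki, TG III §4 no. 1). [folklore] -/
theorem isProperMap_mk (hC : IsCompact (C : Set G)) :
    IsProperMap (QuotientGroup.mk : G → G ⧸ C) := by
  rw [isProperMap_iff_isClosedMap_and_compact_fibers]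
  refine ⟨QuotientGroup.continuous_mk, QuotientGroup.isClosedMap_coe hC, fun y => ?_⟩
  induction y using QuotientGroup.induction_on with
  | H g => rw [preimage_mk_singleton]; exact hC.image (continuous_const.mul continuous_id)

/-- For `C` compact, the left action of `G` on `G ⧸ C` is proper (Bourbaki, TG III §4 no. 2). [folklore] -/
theorem properSMul_quotient (hC : IsCompact (C : Set G)) : ProperSMul G (G ⧸ C) := by
  refine MulAction.properSMul_of_proper_orbitMap (x := (QuotientGroup.mk 1 : G ⧸ C)) ?_
  have h : (fun g : G => g • (QuotientGroup.mk 1 : G ⧸ C)) = QuotientGroup.mk := by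
    funext g
    rw [MulAction.Quotient.smul_mk, smul_eq_mul, mul_one]
  rw [h]
  exact isProperMap_mk C hC

/-- For `C` compact and `Γ` closed, the action of `Γ` on `G ⧸ C` is proper. [folklore] -/
theorem properSMul_subgroup_quotient (hC : IsCompact (C : Set G)) (Γ : Subgroup G)
    (hΓ : IsClosed (Γ : Set G)) : ProperSMul Γ (G ⧸ C) := by
  haveI := properSMul_quotient C hC
  exact properSMul_of_isClosedEmbedding Γ.subtype hΓ.isClosedEmbedding_subtypeVal fun _ _ => rfl

/-- **Hausdorff orbit space.** For `C` compact and `Γ` closed, `Γ \ (G ⧸ C)` is Hausdorff. [folklore] -/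
theorem t2Space_orbitQuotient (hC : IsCompact (C : Set G)) (Γ : Subgroup G)
    (hΓ : IsClosed (Γ : Set G)) :
    T2Space (Quotient (MulAction.orbitRel Γ (G ⧸ C))) := by
  haveI := properSMul_subgroup_quotient C hC Γ hΓ
  exact t2Space_quotient_mulAction_of_properSMul

/-- Discrete subgroups of a Hausdorff group are closed: the discrete case of `t2Space_orbitQuotient` —
for `C` compact and `Γ` discrete, `Γ \ (G ⧸ C)` is Hausdorff. [folklore] -/
theorem t2Space_orbitQuotient_of_discrete [T2Space G] (hC : IsCompact (C : Set G)) (Γ : Subgroup G)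
    [DiscreteTopology Γ] : T2Space (Quotient (MulAction.orbitRel Γ (G ⧸ C))) :=
  t2Space_orbitQuotient C hC Γ Subgroup.isClosed_of_discrete

end General

end Subgroup

end Literature.Topology.Algebra

end
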